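import Summits.QuantumAdvantage.QuantumAdvantage.Theorems.MobiusLadderLiouvilleOrthogonalTC0StubKaneSens
import Summits.QuantumAdvantage.QuantumAdvantage.Theorems.MobiusLadderLiouvilleOrthogonalTC0StubOrLtfTranslate
import Summits.QuantumAdvantage.QuantumAdvantage.Theorems.MobiusLadderLiouvilleOrthogonalTC0SpectralLevel
import HarnessLib

/-!
# Crux `MobiusLadder.LiouvilleOrthogonalTC0` (stmt-QuantumAdvantage-1393): `λ` is orthogonal to every
AND / OR of polynomially many linear threshold tests of the binary digits (the depth-two `∧/∨`-top rung)

Line `Sketch`, skeleton v6 (leads `prover-line-stmt-QuantumAdvantage-1393-c3-0` / `-c4-0`). The glue of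
the v6 stubs, unconditionally:

* `OrLtf.sens_orLtf_le` — for `F(x) = b ⊕ [∃ a < K, t_a ≤ Σ_i w_{a,i} x_i]` (a possibly negated OR of `K`
  integer linear threshold tests of `n` Boolean variables) and EVERY partition `π : [n] → [m]`, `m ≥ 1`,
  the number of pairs (point, sensitive block) is `≤ (4√log((K+1)(m+1)) + 8) · 2ⁿ √m`: average over the
  translates `x ⊕ π^*σ` (`StubPeresTail.sum_le_of_translates`); each translate is an OR of `K` unate
  functions of `σ ∈ {0,1}^m` (`stub_orLtf_translate`), whose sensitivity is bounded by KANE'S THEOREM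
  (`stub_kaneSens`: D. M. Kane, *The average sensitivity of an intersection of half spaces*, STOC 2014,
  Prop. 3, in counting form);
* `OrLtf.tailWeight_orLtf_le` — hence `W^{≥ m}[sgn ∘ F] ≤ 3(4√log((K+1)(m+1)) + 8)/√m` (`m ≥ 10`) by
  Peres' conclusion with a constant (`stub_tailOfSens`);
* `liouville_orthogonal_orLtf` — for every exponent `A`, every `ε > 0`, eventually in `n`, for all
  `K ≤ n^A`: `|Σ_{N<2ⁿ} λ(N) sgn F(bits N)| ≤ ε 2ⁿ`, by the single-level spectral criterion
  `liouville_orthogonal_of_tailWeight_level` (Bourgain's uniform Möbius–Walsh bound + Green §2) at the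
  level `⌊n^{1/R}⌋₊ + 1`, where the tail is `≪ √(log n) · n^{-1/(2R)} → 0`;
* `liouville_orthogonal_andLtf` — the same for `AND`s of `K ≤ n^A` tests (De Morgan: the negation of an
  integer test is an integer test).

In circuit terms (with the landed normal form `stub_depthTwo_nf`): `λ` is orthogonal to every `tcBasis`
circuit of `acDepth ≤ 2` whose top threshold gate is `∧` or `∨`, of ANY polynomial size — intersections
and unions of polynomially many halfspaces in the digits. Registered stub `stub_orLtf` (verbatim wrapper).
-/

set_option linter.dupNamespace false -- D-0017: single-problem summit ⇒ `QuantumAdvantage.QuantumAdvantage` by design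

noncomputable section

namespace Summit.QuantumAdvantage.QuantumAdvantage.Theorems.LiouvilleOrthogonalTC0

open Filter Finset Topology
open Literature.Computability.Complexity
open Literature.Computability.Complexity.LowDegree (tailWeight)
open Literature.Probability.RandomGraphs.LowDegree (sgn)
open Literature.NumberTheory.Sieve

namespace OrLtf

variable {n m K : ℕ}

open StubPeresTail in
/-- **Block sensitivity of a (possibly negated) OR of `K` integer threshold tests** along any partition
`π : [n] → [m]` (`m ≥ 1`) is `≤ (4√log((K+1)(m+1)) + 8) · 2ⁿ √m`: Kane's theorem on each translate. -/
theorem sens_orLtf_le (hm : 1 ≤ m) (b : Bool) (w : Fin K → Fin n → ℤ) (t : Fin K → ℤ)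
    (π : Fin n → Fin m) :
    ∑ x : Fin n → Bool, ((univ.filter fun j : Fin m =>
        xor b (decide (∃ a : Fin K, t a ≤ ∑ i, w a i * (if x i then (1 : ℤ) else 0))) ≠
          xor b (decide (∃ a : Fin K, t a ≤ ∑ i, w a i *
            (if xor (x i) (decide (π i = j)) then (1 : ℤ) else 0)))).card : ℝ)
      ≤ (4 * Real.sqrt (Real.log ((K + 1) * (m + 1))) + 8) * (2 ^ n * Real.sqrt m) := by
  set B : ℝ := 4 * Real.sqrt (Real.log ((K + 1) * (m + 1))) + 8 with hBdef
  have key := sum_le_of_translates π (fun y : Fin n → Bool => ((univ.filter fun j : Fin m =>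
      xor b (decide (∃ a : Fin K, t a ≤ ∑ i, w a i * (if y i then (1 : ℤ) else 0))) ≠
        xor b (decide (∃ a : Fin K, t a ≤ ∑ i, w a i *
          (if xor (y i) (decide (π i = j)) then (1 : ℤ) else 0)))).card : ℝ))
    (B * Real.sqrt m) (fun x => ?_)
  · calc _ ≤ 2 ^ n * (B * Real.sqrt m) := key
      _ = B * (2 ^ n * Real.sqrt m) := by ring
  -- the translate at the base point `x` is an OR of `K` unate functions of `σ`
  obtain ⟨f, o, hf, hF⟩ := stub_orLtf_translate w t π x
  have hK := stub_kaneSens hm f o hf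
  have hpt : ∀ σ : Fin m → Bool,
      ((univ.filter fun j : Fin m =>
        xor b (decide (∃ a : Fin K, t a ≤ ∑ i, w a i *
            (if xor (x i) (σ (π i)) then (1 : ℤ) else 0))) ≠
          xor b (decide (∃ a : Fin K, t a ≤ ∑ i, w a i *
            (if xor (xor (x i) (σ (π i))) (decide (π i = j)) then (1 : ℤ) else 0)))).card : ℝ)
        = ((univ.filter fun j : Fin m =>
            decide (∃ a : Fin K, f a σ = true) ≠
              decide (∃ a : Fin K, f a (Function.update σ j (!σ j)) = true)).card : ℝ) := by
    intro σ
    congr 1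
    refine congrArg Finset.card (Finset.filter_congr fun j _ => ?_)
    have h1 := hF σ
    have h2 := hF (Function.update σ j (!σ j))
    simp_rw [xor_update_not] at h2
    rw [h1, h2]
    exact Bool.xor_right_inj.not
  simp only [hpt]
  calc _ ≤ B * (2 ^ m * Real.sqrt m) := hK
    _ = 2 ^ m * (B * Real.sqrt m) := by ring

/-- **Uniform Fourier tail of a (possibly negated) OR of `K` integer threshold tests**:
`W^{≥ m}[sgn ∘ F] ≤ 3 (4√log((K+1)(m+1)) + 8)/√m` for `m ≥ 10`, uniformly in `n` and the tests. -/
theorem tailWeight_orLtf_le (hm : 10 ≤ m) (b : Bool) (w : Fin K → Fin n → ℤ) (t : Fin K → ℤ) :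
    tailWeight (fun x : Fin n → Bool =>
        sgn (xor b (decide (∃ a : Fin K, t a ≤ ∑ i, w a i * (if x i then (1 : ℤ) else 0))))) m
      ≤ 3 * (4 * Real.sqrt (Real.log ((K + 1) * (m + 1))) + 8) / Real.sqrt m :=
  stub_tailOfSens hm
    (fun x : Fin n → Bool => xor b (decide (∃ a : Fin K, t a ≤ ∑ i, w a i * (if x i then (1 : ℤ) else 0))))
    (fun π => sens_orLtf_le (by omega) b w t π)

/-- Parameter arithmetic: for `n ≥ 2`, `K ≤ n^A` and `k ≤ n`, `(K+1)(k+2) ≤ n^{A+3}`. -/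
theorem log_arg_le {A n K k : ℕ} (hn : 2 ≤ n) (hK : K ≤ n ^ A) (hk : k ≤ n) :
    ((K : ℝ) + 1) * ((((k + 1 : ℕ) : ℝ)) + 1) ≤ (n : ℝ) ^ (A + 3) := by
  have h1 : K + 1 ≤ 2 * n ^ A := by
    have : 1 ≤ n ^ A := Nat.one_le_pow _ _ (by omega)
    omega
  have h2 : k + 1 + 1 ≤ 2 * n := by omega
  have h3 : (K + 1) * (k + 1 + 1) ≤ n ^ (A + 3) := by
    calc (K + 1) * (k + 1 + 1) ≤ (2 * n ^ A) * (2 * n) := Nat.mul_le_mul h1 h2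
      _ = 4 * n ^ (A + 1) := by ring
      _ ≤ n ^ 2 * n ^ (A + 1) := by
          refine Nat.mul_le_mul_right _ ?_
          calc 4 = 2 ^ 2 := by norm_num
            _ ≤ n ^ 2 := Nat.pow_le_pow_left hn 2
      _ = n ^ (A + 3) := by ring
  exact_mod_cast h3

/-- The decay of the tail bound: `12 √((A+3)/δ) · n^{-δ/2} + 24 · n^{-δ} → 0` (`δ > 0`). -/
theorem tendsto_decay (A : ℕ) {δ : ℝ} (hδ : 0 < δ) :
    Tendsto (fun n : ℕ => 12 * Real.sqrt ((A + 3) / δ) * (n : ℝ) ^ (-(δ / 2)) + 24 * (n : ℝ) ^ (-δ))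
      atTop (𝓝 0) := by
  have h1 : Tendsto (fun n : ℕ => (n : ℝ) ^ (-(δ / 2))) atTop (𝓝 0) :=
    (tendsto_rpow_neg_atTop (by positivity)).comp tendsto_natCast_atTop_atTop
  have h2 : Tendsto (fun n : ℕ => (n : ℝ) ^ (-δ)) atTop (𝓝 0) :=
    (tendsto_rpow_neg_atTop hδ).comp tendsto_natCast_atTop_atTop
  simpa using (h1.const_mul (12 * Real.sqrt ((A + 3) / δ))).add (h2.const_mul 24)

/-- The tail bound at the spectral level, bounded by the decaying majorant: for `n ≥ 2`, `K ≤ n^A`,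
`k ≤ n` with `n^{2δ} < k + 1` (`δ > 0`),
`3(4√log((K+1)(k+2)) + 8)/√(k+1) ≤ 12√((A+3)/δ) n^{-δ/2} + 24 n^{-δ}`. -/
theorem tail_bound_le {A n K k : ℕ} {δ : ℝ} (hδ : 0 < δ) (hn : 2 ≤ n) (hK : K ≤ n ^ A) (hk : k ≤ n)
    (hlev : (n : ℝ) ^ (2 * δ) < (k : ℝ) + 1) :
    3 * (4 * Real.sqrt (Real.log ((K + 1) * ((((k + 1 : ℕ) : ℝ)) + 1))) + 8) / Real.sqrt ((((k + 1 : ℕ) : ℝ)))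
      ≤ 12 * Real.sqrt ((A + 3) / δ) * (n : ℝ) ^ (-(δ / 2)) + 24 * (n : ℝ) ^ (-δ) := by
  have hnpos : (0 : ℝ) < n := by exact_mod_cast (show 0 < n by omega)
  have hn1 : (1 : ℝ) ≤ n := by exact_mod_cast (show 1 ≤ n by omega)
  -- the logarithm: `log((K+1)(k+2)) ≤ (A+3) log n ≤ (A+3) n^δ/δ`
  have harg_pos : (0 : ℝ) < ((K : ℝ) + 1) * ((((k + 1 : ℕ) : ℝ)) + 1) := by positivity
  have hlog1 : Real.log (((K : ℝ) + 1) * ((((k + 1 : ℕ) : ℝ)) + 1)) ≤ (A + 3) * Real.log n := by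
    calc Real.log (((K : ℝ) + 1) * ((((k + 1 : ℕ) : ℝ)) + 1)) ≤ Real.log ((n : ℝ) ^ (A + 3)) :=
          Real.log_le_log harg_pos (log_arg_le hn hK hk)
      _ = (A + 3) * Real.log n := by rw [Real.log_pow]; push_cast; ring
  have hlog2 : Real.log (n : ℝ) ≤ (n : ℝ) ^ δ / δ := Real.log_natCast_le_rpow_div n hδ
  have hA3 : (0 : ℝ) ≤ (A : ℝ) + 3 := by positivity
  have hlog3 : Real.log (((K : ℝ) + 1) * ((((k + 1 : ℕ) : ℝ)) + 1)) ≤ (A + 3) / δ * (n : ℝ) ^ δ := by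
    calc _ ≤ (A + 3) * Real.log n := hlog1
      _ ≤ (A + 3) * ((n : ℝ) ^ δ / δ) := mul_le_mul_of_nonneg_left hlog2 hA3
      _ = (A + 3) / δ * (n : ℝ) ^ δ := by ring
  have hhalf : Real.sqrt ((n : ℝ) ^ δ) = (n : ℝ) ^ (δ / 2) := by
    rw [Real.sqrt_eq_rpow, ← Real.rpow_mul hnpos.le]
    congr 1
    ring
  have hsqrtlog : Real.sqrt (Real.log (((K : ℝ) + 1) * ((((k + 1 : ℕ) : ℝ)) + 1))) ≤
      Real.sqrt ((A + 3) / δ) * (n : ℝ) ^ (δ / 2) := by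
    calc _ ≤ Real.sqrt ((A + 3) / δ * (n : ℝ) ^ δ) := Real.sqrt_le_sqrt hlog3
      _ = Real.sqrt ((A + 3) / δ) * Real.sqrt ((n : ℝ) ^ δ) :=
          Real.sqrt_mul (by positivity) _
      _ = Real.sqrt ((A + 3) / δ) * (n : ℝ) ^ (δ / 2) := by rw [hhalf]
  -- the level: `n^δ ≤ √(k+1)`
  have hsqrt : (n : ℝ) ^ δ ≤ Real.sqrt ((((k + 1 : ℕ) : ℝ))) := by
    have h1 : Real.sqrt ((n : ℝ) ^ (2 * δ)) ≤ Real.sqrt ((k : ℝ) + 1) := Real.sqrt_le_sqrt hlev.le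
    have h2 : Real.sqrt ((n : ℝ) ^ (2 * δ)) = (n : ℝ) ^ δ := by
      rw [Real.sqrt_eq_rpow, ← Real.rpow_mul hnpos.le]
      congr 1
      ring
    rw [h2] at h1
    push_cast
    exact h1
  have hpow_pos : (0 : ℝ) < (n : ℝ) ^ δ := Real.rpow_pos_of_pos hnpos _
  have hs0 : (0 : ℝ) < Real.sqrt ((((k + 1 : ℕ) : ℝ))) := lt_of_lt_of_le hpow_pos hsqrt
  -- assemble
  have hnum_nonneg : (0 : ℝ) ≤ 3 * (4 * Real.sqrt (Real.log (((K : ℝ) + 1) * ((((k + 1 : ℕ) : ℝ)) + 1))) + 8) := by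
    positivity
  calc 3 * (4 * Real.sqrt (Real.log (((K : ℝ) + 1) * ((((k + 1 : ℕ) : ℝ)) + 1))) + 8) /
        Real.sqrt ((((k + 1 : ℕ) : ℝ)))
      ≤ 3 * (4 * Real.sqrt (Real.log (((K : ℝ) + 1) * ((((k + 1 : ℕ) : ℝ)) + 1))) + 8) / (n : ℝ) ^ δ :=
        div_le_div_of_nonneg_left hnum_nonneg hpow_pos hsqrt
    _ ≤ 3 * (4 * (Real.sqrt ((A + 3) / δ) * (n : ℝ) ^ (δ / 2)) + 8) / (n : ℝ) ^ δ := by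
        gcongr
    _ = 12 * Real.sqrt ((A + 3) / δ) * ((n : ℝ) ^ (δ / 2) / (n : ℝ) ^ δ) + 24 * (1 / (n : ℝ) ^ δ) := by
        ring
    _ = 12 * Real.sqrt ((A + 3) / δ) * (n : ℝ) ^ (-(δ / 2)) + 24 * (n : ℝ) ^ (-δ) := by
        congr 2
        · rw [← Real.rpow_sub hnpos]
          congr 1
          ring
        · rw [one_div, Real.rpow_neg hnpos.le]

end OrLtf

open OrLtf in
/-- **`λ` is orthogonal to every (possibly negated) OR of polynomially many linear threshold tests of the
binary digits** (unconditional; the depth-two `∨`-top / `∧`-top rung of the line): for every exponent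
`A` and every `ε > 0`, for all sufficiently large `n`, for all `K ≤ n^A`, `b`, and all integer tests
`L_a(N) = [t_a ≤ Σ_i w_{a,i} bit_i(N)]` (`a < K`),
`|Σ_{N<2ⁿ} λ(N) · sgn (b ⊕ [∃ a, L_a(N)])| ≤ ε · 2ⁿ`. Kane's theorem (`stub_kaneSens`) ⇒ uniform
block-sensitivity bound ⇒ Peres-type tail bound (`tailWeight_orLtf_le`) ⇒ the single-level spectral
criterion `liouville_orthogonal_of_tailWeight_level` (Bourgain + Green). -/
theorem liouville_orthogonal_orLtf (A : ℕ) : ∀ ε : ℝ, 0 < ε → ∀ᶠ n : ℕ in atTop, ∀ K : ℕ, K ≤ n ^ A →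
    ∀ (b : Bool) (w : Fin K → Fin n → ℤ) (t : Fin K → ℤ),
      |∑ N ∈ Finset.range (2 ^ n), ((ArithmeticFunction.liouville N : ℤ) : ℝ) *
          sgn (xor b (decide (∃ a : Fin K,
            t a ≤ ∑ i, w a i * (if Nat.testBit N i then (1 : ℤ) else 0))))| ≤ ε * (2 : ℝ) ^ n := by
  obtain ⟨c, hc, hB⟩ := bourgain_liouville_walsh_holds
  set R : ℕ := ⌈(3 : ℝ) / c⌉₊ with hRdef
  have hR1 : 1 ≤ R := by
    have : (0 : ℝ) < 3 / c := by positivity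
    exact Nat.one_le_iff_ne_zero.mpr (Nat.pos_iff_ne_zero.mp (Nat.ceil_pos.mpr this))
  have hRc : 3 ≤ (R : ℝ) * c := by
    have h1 : (3 : ℝ) / c ≤ R := Nat.le_ceil _
    have := mul_le_mul_of_nonneg_right h1 hc.le
    rwa [div_mul_cancel₀ _ hc.ne'] at this
  have hRpos : (0 : ℝ) < R := by exact_mod_cast (show 0 < R by omega)
  -- `δ = 1/(2R)`: the level `⌊n^{1/R}⌋₊ + 1` exceeds `n^{2δ} = n^{1/R}`
  set δ : ℝ := 1 / (2 * R) with hδdef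
  have hδ : 0 < δ := by positivity
  have h2δ : 2 * δ = 1 / R := by rw [hδdef]; field_simp
  intro ε hε
  have hε3 : 0 < (ε / 3) ^ 2 := by positivity
  have hlev9 : ∀ᶠ n : ℕ in atTop, 9 ≤ ⌊((n : ℝ)) ^ ((1 : ℝ) / R)⌋₊ :=
    (LtfCore.tendsto_floor_rpow hR1).eventually (eventually_ge_atTop 9)
  filter_upwards [liouville_orthogonal_of_tailWeight_level hc hB hR1 hRc ε hε,
    (tendsto_decay A hδ).eventually_le_const hε3, hlev9, eventually_ge_atTop 2]
    with n hn hsmall h9 hn2 K hK b w t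
  refine hn (fun y => xor b (decide (∃ a : Fin K, t a ≤ ∑ i, w a i * (if y i then (1 : ℤ) else 0)))) ?_
  set kk : ℕ := ⌊((n : ℝ)) ^ ((1 : ℝ) / R)⌋₊ with hkkdef
  have htail := tailWeight_orLtf_le (m := kk + 1) (by omega) b w t
  refine htail.trans (le_trans ?_ hsmall)
  -- `kk ≤ n` and `n^{1/R} < kk + 1`
  have hkn : kk ≤ n := by
    have h := LtfCore.floor_rpow_pow_le hR1 n
    calc kk = kk ^ 1 := (pow_one _).symm
      _ ≤ kk ^ R := Nat.pow_le_pow_right (by omega) hR1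
      _ ≤ n := h
  have hlev : (n : ℝ) ^ (2 * δ) < (kk : ℝ) + 1 := by
    rw [h2δ]; exact Nat.lt_floor_add_one _
  have hcast : ((K : ℝ) + 1) * ((kk + 1 : ℕ) + 1 : ℝ) = (K + 1) * ((((kk + 1 : ℕ) : ℝ)) + 1) := by
    push_cast; ring
  exact tail_bound_le hδ hn2 hK hkn hlev

/-- **`λ` is orthogonal to every AND of polynomially many linear threshold tests of the binary digits**
(intersections of `≤ n^A` halfspaces; the `∧`-top case): De Morgan, the complement of the integer test
`[t ≤ L]` being the integer test `[1 - t ≤ -L]`. -/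
theorem liouville_orthogonal_andLtf (A : ℕ) : ∀ ε : ℝ, 0 < ε → ∀ᶠ n : ℕ in atTop, ∀ K : ℕ, K ≤ n ^ A →
    ∀ (b : Bool) (w : Fin K → Fin n → ℤ) (t : Fin K → ℤ),
      |∑ N ∈ Finset.range (2 ^ n), ((ArithmeticFunction.liouville N : ℤ) : ℝ) *
          sgn (xor b (decide (∀ a : Fin K,
            t a ≤ ∑ i, w a i * (if Nat.testBit N i then (1 : ℤ) else 0))))| ≤ ε * (2 : ℝ) ^ n := by
  intro ε hε
  filter_upwards [liouville_orthogonal_orLtf A ε hε] with n hn K hK b w t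
  have h := hn K hK (!b) (fun a i => -w a i) (fun a => 1 - t a)
  have key : ∀ N : ℕ, xor b (decide (∀ a : Fin K,
      t a ≤ ∑ i, w a i * (if Nat.testBit N i then (1 : ℤ) else 0))) =
        xor (!b) (decide (∃ a : Fin K,
          1 - t a ≤ ∑ i, -w a i * (if Nat.testBit N i then (1 : ℤ) else 0))) := by
    intro N
    have e : decide (∀ a : Fin K, t a ≤ ∑ i, w a i * (if Nat.testBit N i then (1 : ℤ) else 0)) =
        !decide (∃ a : Fin K, 1 - t a ≤ ∑ i, -w a i * (if Nat.testBit N i then (1 : ℤ) else 0)) := by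
      simp only [neg_mul, Finset.sum_neg_distrib]
      rw [Bool.eq_iff_iff]
      simp only [decide_eq_true_eq, Bool.not_eq_true', decide_eq_false_iff_not, not_exists, not_le]
      exact forall_congr' fun a => by omega
    rw [e]
    cases b <;> simp
  simp only [key]
  exact h

/-- **Registered stub `stub_orLtf`** (line `Sketch`, skeleton v6): verbatim `liouville_orthogonal_orLtf`. -/
theorem stub_orLtf (A : ℕ) : ∀ ε : ℝ, 0 < ε → ∀ᶠ n : ℕ in atTop, ∀ K : ℕ, K ≤ n ^ A → ∀ (b : Bool) (w : Fin K → Fin n → ℤ) (t : Fin K → ℤ), |∑ N ∈ Finset.range (2 ^ n), ((ArithmeticFunction.liouville N : ℤ) : ℝ) * sgn (xor b (decide (∃ a : Fin K, t a ≤ ∑ i, w a i * (if Nat.testBit N i then (1 : ℤ) else 0))))| ≤ ε * (2 : ℝ) ^ n :=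
  liouville_orthogonal_orLtf A

end Summit.QuantumAdvantage.QuantumAdvantage.Theorems.LiouvilleOrthogonalTC0

end
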